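import Literature.Barriers.CriticalPhenomena.PositionSpaceRGNonGibbsianThm43Contours
import Literature.Barriers.CriticalPhenomena.PositionSpaceRGNonGibbsianThm43FlipShift
import Literature.Probability.LatticeModels.PSPolymerActivity
import HarnessLib

/-!
# Barrier `PositionSpaceRGNonGibbsian`, Theorem 4.3 for all spacings `b ≥ 2`: the Peierls estimate for
# the internal-spin system with fully alternating image spins (contour erasure by flip∘shift)

Companion file on the Theorem 4.3 line of
`Literature/Barriers/CriticalPhenomena/PositionSpaceRGNonGibbsian.lean` (van Enter–Fernández–Sokal,
J. Stat. Phys. **72** (1993) 879, arXiv:hep-lat/9210032, §4.3.2 and App. B.5.3). The source proves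
the low-temperature order of the internal-spin system with fully alternating image spins by
Pirogov–Sinai theory; here it is proved by a Peierls argument: a thick contour `γ`
(`…Thm43Contours.lean`) of a configuration of the finite-volume system `Λ^int_{R'}` (all image spins of
`Λ_{R'}` alternating with parity `p`, everything else `+`) is ERASED by overwriting its internal
sites with its exterior label `s` and applying flip∘translation-by-`b e₁` to its interior
components of label `-s` (`eraseContour`); by the energy identities of `…Thm43FlipShift.lean` and
the tree's Peierls condition this lowers the energy by at least `#γ / (2R+1)^d` (`R = b + 1` the
goodness radius), the erasure is injective given `γ` and the configuration on the
`(R+1)`-neighbourhood of `γ`, and contours are `★`-lattice animals; hence the probability that the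
internal spin next to the origin is `-1` is small for large `β`, uniformly in the volume
(`isingExpect_neg_indicator_le`), for both parities `p`.

Nothing is asserted: the file is sorry-free and introduces no named fact (D-0014, D-0026).

## References

* A. C. D. van Enter, R. Fernández, A. D. Sokal, J. Stat. Phys. 72 (1993) 879–1167,
  arXiv:hep-lat/9210032 — §4.3.2 and App. B.5.3 [VanenterFernandezSokal1993].
* S. Friedli, Y. Velenik, *Statistical Mechanics of Lattice Systems*, CUP 2017, §3.7.2
  (Peierls' argument) and §7.2 [FriedliVelenik2017].
-/

noncomputable section

namespace Literature.Barriers.CriticalPhenomena.NonGibbs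

open Finset Relation SimpleGraph Literature.Probability.LatticeModels

variable {d : ℕ}

/-! ### Units bookkeeping -/

/-- Two distinct signs are opposite. [folklore] -/
theorem units_eq_neg_of_ne {u s : ℤˣ} (h : u ≠ s) : u = -s := by
  rcases Int.units_eq_one_or u with rfl | rfl <;> rcases Int.units_eq_one_or s with rfl | rfl <;>
    first | exact absurd rfl h | decide

/-- A sign is not its opposite. [folklore] -/
theorem units_ne_neg_self (s : ℤˣ) : s ≠ -s := by
  rcases Int.units_eq_one_or s with rfl | rfl <;> decide

/-! ### The objects: opposite interior, wrong contour sites, the erased configuration -/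

section Objects

variable (b R : ℕ)

/-- The translation by `-b eᵢ` as a period vector: `x ↦ x - b eᵢ` is `spShift d b (zneg i)`.
[cite: VanenterFernandezSokal1993, App. B.5.3] -/
def zneg (i : Fin d) : Site d := -Pi.single i 1

/-- **The oppositely labelled interior** of a contour: the sites of the interior components whose
label differs from the exterior label. [cite: FriedliVelenik2017, §7.2.6 (interior components of the other type)] -/
def oppSites (σ : SpinConfig (Site d)) (γ : Finset (Site d)) : Finset (Site d) :=
  open Classical in
  (starInt γ).filter fun x => compLabel b R σ (starIntComp γ x) ≠ extLabel b R σ γ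

/-- The internal sites of the oppositely labelled interior (the set flip-shifted by the erasure).
[cite: VanenterFernandezSokal1993, App. B.5.3] -/
def oppInt (σ : SpinConfig (Site d)) (γ : Finset (Site d)) : Finset (Site d) :=
  (oppSites b R σ γ).filter fun x => ¬ IsSpImageSite d b x

/-- **The wrong sites of the contour**: its internal sites whose spin is not the exterior label
(the set flipped by the erasure). [cite: VanenterFernandezSokal1993, App. B.5.3] -/
def wrongSites (σ : SpinConfig (Site d)) (γ : Finset (Site d)) : Finset (Site d) :=
  γ.filter fun g => ¬ IsSpImageSite d b g ∧ σ g = -extLabel b R σ γ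

/-- **The erased configuration**: flip∘shift (by `-b eᵢ`) on the oppositely labelled interior, then
the flip of the wrong contour sites — after which the contour and its neighbourhood are in the
ground state given by the exterior label, and the interior components of the other label have been
moved by one period and flipped (an exact symmetry of the bulk Hamiltonian).
[cite: VanenterFernandezSokal1993, App. B.5.3 (the two ground states ω^{(+)}, ω^{(-)})] -/
def eraseContour (i : Fin d) (σ : SpinConfig (Site d)) (γ : Finset (Site d)) : SpinConfig (Site d) :=
  flipOn (wrongSites b R σ γ) (flipShift (oppInt b R σ γ) (spShift d b (zneg i)) σ)

variable {b R}

/-- Membership in `oppSites`. [folklore] -/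
theorem mem_oppSites {σ : SpinConfig (Site d)} {γ : Finset (Site d)} {x : Site d} :
    x ∈ oppSites b R σ γ ↔ x ∈ starInt γ ∧ compLabel b R σ (starIntComp γ x) ≠ extLabel b R σ γ := by
  classical
  rw [oppSites, mem_filter]

/-- Membership in `oppInt`. [folklore] -/
theorem mem_oppInt {σ : SpinConfig (Site d)} {γ : Finset (Site d)} {x : Site d} :
    x ∈ oppInt b R σ γ ↔ x ∈ oppSites b R σ γ ∧ ¬ IsSpImageSite d b x := by
  rw [oppInt, mem_filter]

/-- Membership in `wrongSites`. [folklore] -/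
theorem mem_wrongSites {σ : SpinConfig (Site d)} {γ : Finset (Site d)} {g : Site d} :
    g ∈ wrongSites b R σ γ ↔ g ∈ γ ∧ ¬ IsSpImageSite d b g ∧ σ g = -extLabel b R σ γ := by
  rw [wrongSites, mem_filter]

/-- `oppSites` is a union of interior components: it is closed under `★`-steps off the contour.
[cite: FriedliVelenik2017, §7.2.6] -/
theorem mem_oppSites_of_adj (hd : 2 ≤ d) {σ : SpinConfig (Site d)} {γ : Finset (Site d)} {x y : Site d}
    (hx : x ∈ oppSites b R σ γ) (hy : y ∉ γ) (hadj : (zdStar d).Adj x y) : y ∈ oppSites b R σ γ := by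
  obtain ⟨hxi, hxl⟩ := mem_oppSites.1 hx
  have hstep : starRel (γ : Set (Site d))ᶜ x y := ⟨hadj, ((mem_starInt hd).1 hxi).1, hy⟩
  have hyi : y ∈ starInt γ := mem_starInt_of_reflTransGen hd hxi (ReflTransGen.single hstep)
  have hcomp : starIntComp γ y = starIntComp γ x :=
    starIntComp_eq_of_mem hd hxi (mem_starIntComp_of_starRel hd hxi (mem_starIntComp_self hd hxi) hstep)
  exact mem_oppSites.2 ⟨hyi, by rwa [hcomp]⟩

/-- A `★`-neighbour of a site of `oppSites` outside `oppSites` lies on the contour. [cite: FriedliVelenik2017, §7.2.6] -/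
theorem mem_of_adj_oppSites (hd : 2 ≤ d) {σ : SpinConfig (Site d)} {γ : Finset (Site d)} {x y : Site d}
    (hx : x ∈ oppSites b R σ γ) (hy : y ∉ oppSites b R σ γ) (hadj : (zdStar d).Adj x y) : y ∈ γ := by
  by_contra hyγ
  exact hy (mem_oppSites_of_adj hd hx hyγ hadj)

/-- **Spins around the collar of an oppositely labelled component are the opposite of the exterior
label.** [cite: FriedliVelenik2017, §7.2.6, Lemma 7.19] -/
theorem apply_eq_neg_extLabel_of_opp (hd : 2 ≤ d) (hb : 2 ≤ b) (hR : 2 ≤ R) {σ : SpinConfig (Site d)}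
    {γ : Finset (Site d)} (hγ : IsContourOf b R σ γ) {x : Site d} (hx : x ∈ oppSites b R σ γ) {c : Site d}
    (hc : c ∈ inBoundary (starIntComp γ x)) {v : Site d} (hv : v ∈ ball R c) (hvi : ¬ IsSpImageSite d b v) :
    σ v = -extLabel b R σ γ := by
  obtain ⟨hxi, hxl⟩ := mem_oppSites.1 hx
  rw [apply_eq_compLabel_of_mem_ball_inBoundary hd hb hR hγ hxi hc hv hvi]
  exact units_eq_neg_of_ne hxl

end Objects

/-! ### Rays inside an interior component: collar sites near the exit -/

section Exit

variable {b R : ℕ}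

/-- The translation by `-b eᵢ` in coordinates. [cite: VanenterFernandezSokal1993, App. B.5.3] -/
theorem spShift_zneg_apply (b : ℕ) (i : Fin d) (x : Site d) :
    spShift d b (zneg i) x = Function.update x i (x i + (b : ℕ) * (-1 : ℤ)) := by
  funext k
  rw [spShift, Site.shift_apply, zneg]
  by_cases hk : k = i
  · subst hk; simp
  · simp [hk]

/-- The translation by `+b eᵢ` in coordinates: the preimage under `spShift d b (zneg i)`.
[cite: VanenterFernandezSokal1993, App. B.5.3] -/
theorem spShift_zneg_update_add (b : ℕ) (i : Fin d) (x : Site d) :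
    spShift d b (zneg i) (Function.update x i (x i + (b : ℕ) * (1 : ℤ))) = x := by
  rw [spShift_zneg_apply]
  funext k
  by_cases hk : k = i
  · subst hk; simp
  · simp [Function.update_of_ne hk]

/-- **Exit of a coordinate segment from an interior component**: if the point `m` steps from `x`
along `± eᵢ` is not in the interior component of `x`, then some collar site of that component lies
on the segment strictly before, within sup-distance `m - 1` of `x` and `m` of the endpoint... precisely:
there is `t ≤ m`, `1 ≤ t`, with the point at step `t` on the contour and the point at step `t - 1` a
collar site. [cite: FriedliVelenik2017, §7.2.6] -/
theorem exists_exit_collar (hd : 2 ≤ d) {γ : Finset (Site d)} {x : Site d} (hx : x ∈ starInt γ) (i : Fin d)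
    {ε : ℤ} (hε : ε = 1 ∨ ε = -1) {m : ℕ} (hm : Function.update x i (x i + m * ε) ∉ starIntComp γ x) :
    ∃ t : ℕ, 1 ≤ t ∧ t ≤ m ∧ Function.update x i (x i + t * ε) ∈ γ ∧
      Function.update x i (x i + (t - 1 : ℕ) * ε) ∈ inBoundary (starIntComp γ x) := by
  obtain ⟨t, ht1, htγ, hbefore⟩ := exists_first_on_ray hd hx i hε
  have htm : t ≤ m := by
    by_contra h
    exact hm (hbefore m (by omega))
  refine ⟨t, ht1, htm, htγ, ?_⟩
  have hcA : Function.update x i (x i + (t - 1 : ℕ) * ε) ∈ starIntComp γ x := hbefore (t - 1) (by omega)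
  refine mem_inBoundary.2 ⟨hcA, Function.update x i (x i + t * ε),
    fun h' => ((mem_starInt hd).1 (starIntComp_subset γ x h')).1 htγ, ?_⟩
  have h1 : Function.update x i (x i + t * ε) =
      Function.update (Function.update x i (x i + (t - 1 : ℕ) * ε)) i
        ((Function.update x i (x i + (t - 1 : ℕ) * ε)) i + ε) := by
    rw [Function.update_idem, Function.update_self]
    congr 1
    have : ((t - 1 : ℕ) : ℤ) = t - 1 := by push_cast [Nat.cast_sub ht1]; ring
    rw [this]; ring
  rw [h1]
  exact zdGraph_le_zdStar (adj_update_add _ i hε)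

/-- Sup-distance along a coordinate segment. [folklore] -/
theorem supDist_update_le (x : Site d) (i : Fin d) (c : ℤ) {n : ℕ} (h : (c - x i).natAbs ≤ n) :
    supDist (Function.update x i c) x ≤ n := by
  rw [supDist_le_iff]
  intro k
  by_cases hk : k = i
  · subst hk; rw [Function.update_self]; exact h
  · rw [Function.update_of_ne hk]; simp

end Exit

/-! ### The finite-volume systems: alternating image spins on `Λ_{R'}`, `+` elsewhere -/

section System

variable {b : ℕ}

/-- The shift by `-b eᵢ` as a difference. [folklore] -/
theorem spShift_zneg_eq_sub (b : ℕ) (i : Fin d) (x : Site d) :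
    spShift d b (zneg i) x = x - (b : ℤ) • (Pi.single i (1 : ℤ) : Site d) := by
  rw [spShift_apply, zneg, smul_neg, sub_eq_add_neg]

/-- **Alternation of the frozen image spins under the period shift**: inside `Λ_{R'}` the
configuration `p·ω'_alt` (on the image sites of `box d (bR')`) changes sign under `a ↦ a - b eᵢ`.
[cite: VanenterFernandezSokal1993, §4.3.2 and App. B.5.3] -/
theorem signedCoreAnnulusBC_sub_period (hb : 0 < b) (p : ℤˣ) (R' : ℕ) {a : Site d} (ha : IsSpImageSite d b a)
    (i : Fin d) (h1 : a ∈ box d (b * R')) (h2 : a - (b : ℤ) • (Pi.single i (1 : ℤ) : Site d) ∈ box d (b * R')) :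
    signedCoreAnnulusBC d b p R' R' 1 1 (a - (b : ℤ) • (Pi.single i (1 : ℤ) : Site d)) =
      -signedCoreAnnulusBC d b p R' R' 1 1 a := by
  classical
  set x : Site d := fun j => a j / b with hx
  have hax : a = fun j => (b : ℤ) * x j := eq_mul_ediv_of_isSpImageSite ha
  have hxR : x ∈ box d R' := ediv_mem_box_of_mem_box hb ha h1
  have ha' : a - (b : ℤ) • (Pi.single i (1 : ℤ) : Site d) = fun j => (b : ℤ) * (x + (-1 : ℤ) • (Pi.single i (1 : ℤ) : Site d)) j := by
    funext j
    rw [Pi.sub_apply, congrFun hax j, add_zsmul_single_apply]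
    simp only [Pi.smul_apply, Pi.single_apply, smul_eq_mul]
    split_ifs <;> ring
  have himg' : IsSpImageSite d b (a - (b : ℤ) • (Pi.single i (1 : ℤ) : Site d)) := by
    rw [ha']; exact fun j => dvd_mul_right _ _
  have hxR' : x + (-1 : ℤ) • (Pi.single i (1 : ℤ) : Site d) ∈ box d R' := by
    have := ediv_mem_box_of_mem_box hb himg' h2
    rw [ha'] at this
    convert this using 1
    funext j
    simp only
    rw [Int.mul_ediv_cancel_left _ (by exact_mod_cast hb.ne')]
  rw [ha', signedCoreAnnulusBC_apply_image (d := d) hb, if_pos hxR', hax,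
    signedCoreAnnulusBC_apply_image (d := d) hb, if_pos hxR, altConfig_add_zsmul_single x i (Or.inr rfl), mul_neg]

/-- **The image field is anti-periodic**: for an internal site `u` with `u` and `u - b eᵢ` in the cube
`box d (bR')`, `h^ζ(u - b eᵢ) = -h^ζ(u)` for the alternating image spins `ζ` of `Λ_{R'}`.
[cite: VanenterFernandezSokal1993, §4.3.2 and App. B.5.3] -/
theorem imgField_spShift_zneg (hb : 2 ≤ b) (p : ℤˣ) (R' : ℕ) (i : Fin d) {u : Site d}
    (hu1 : u ∈ box d (b * R')) (hu2 : spShift d b (zneg i) u ∈ box d (b * R')) :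
    imgField d b (signedCoreAnnulusBC d b p R' R' 1 1) (spShift d b (zneg i) u) =
      -imgField d b (signedCoreAnnulusBC d b p R' R' 1 1) u := by
  rw [imgField, imgField, imgNbrs_spShift, sum_map, ← sum_neg_distrib]
  refine sum_congr rfl fun a ha => ?_
  obtain ⟨hadj, haimg⟩ := mem_imgNbrs.1 ha
  have ha1 : a ∈ box d (b * R') := mem_box_of_mem_imgNbrs hb hu1 ha
  have ha2' : (spShift d b (zneg i)).toEmbedding a ∈ imgNbrs d b (spShift d b (zneg i) u) := by
    rw [imgNbrs_spShift]; exact mem_map_of_mem _ ha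
  have ha2 : spShift d b (zneg i) a ∈ box d (b * R') := mem_box_of_mem_imgNbrs hb hu2 ha2'
  rw [spShift_zneg_eq_sub] at ha2
  change spinAt (spShift d b (zneg i) a) _ = _
  rw [spShift_zneg_eq_sub, spinAt, spinAt, signedCoreAnnulusBC_sub_period (by omega) p R' haimg i ha1 ha2,
    Units.val_neg, Int.cast_neg]

/-- **The opposite-parity pattern has the opposite image field** on the sites of the cube.
[cite: VanenterFernandezSokal1993, §4.3.2] -/
theorem imgField_signedCoreAnnulusBC_neg_parity (hb : 2 ≤ b) (p : ℤˣ) (R' : ℕ) {u : Site d}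
    (hu : u ∈ box d (b * R')) :
    imgField d b (signedCoreAnnulusBC d b (-p) R' R' 1 1) u = -imgField d b (signedCoreAnnulusBC d b p R' R' 1 1) u := by
  classical
  rw [imgField, imgField, ← sum_neg_distrib]
  refine sum_congr rfl fun a ha => ?_
  obtain ⟨-, haimg⟩ := mem_imgNbrs.1 ha
  have habox : a ∈ box d (b * R') := mem_box_of_mem_imgNbrs hb hu ha
  set x : Site d := fun j => a j / b with hx
  have hax : a = fun j => (b : ℤ) * x j := eq_mul_ediv_of_isSpImageSite haimg
  have hxR : x ∈ box d R' := ediv_mem_box_of_mem_box (by omega) haimg habox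
  rw [spinAt, spinAt, hax, signedCoreAnnulusBC_apply_image (d := d) (by omega), if_pos hxR,
    signedCoreAnnulusBC_apply_image (d := d) (by omega), if_pos hxR, neg_mul, Units.val_neg, Int.cast_neg]

/-- **Configurations of the system `⟨Λ^int_{R'}; p·ω'_alt; +⟩`**: equal to the alternating/`+`
boundary condition off the volume of internal sites of the cube. They are `+` outside the cube.
[cite: VanenterFernandezSokal1993, §4.3.1 Step 2] -/
theorem plusOutside_of_eqOn {p : ℤˣ} {R' : ℕ} {σ : SpinConfig (Site d)}
    (hσ : ∀ x, x ∉ spacingIntVolume d b R' → σ x = signedCoreAnnulusBC d b p R' R' 1 1 x) :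
    PlusOutside b (b * R') σ := by
  intro v hvi hvb
  rw [hσ v fun h => hvb (mem_box_of_mem_spacingIntVolume h), signedCoreAnnulusBC_apply_internal p R' R' 1 1 hvi]

variable {R : ℕ}

/-- **The oppositely labelled interior lies deep inside the cube** (`|x_k| + R ≤ bR'` in every
coordinate): for exterior label `+` its components are labelled `-1`
(`natAbs_add_le_of_compLabel`); for exterior label `-1` the whole contour is deep
(`natAbs_add_le_of_extLabel`) and the interior lies in its coordinate box.
[cite: VanenterFernandezSokal1993, §4.3.1 Step 2; FriedliVelenik2017, §7.2.6] -/
theorem natAbs_add_le_of_mem_oppSites (hd : 2 ≤ d) (hb : 2 ≤ b) (hR : 2 ≤ R) {N : ℕ} {σ : SpinConfig (Site d)}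
    (hω : PlusOutside b N σ) {γ : Finset (Site d)} (hγ : IsContourOf b R σ γ) {x : Site d}
    (hx : x ∈ oppSites b R σ γ) (k : Fin d) : (x k).natAbs + R ≤ N := by
  obtain ⟨hxi, hxl⟩ := mem_oppSites.1 hx
  rcases Int.units_eq_one_or (extLabel b R σ γ) with hs | hs
  · rw [hs] at hxl
    exact natAbs_add_le_of_compLabel hd hb hR hω hγ hxi (units_eq_neg_of_ne hxl) (mem_starIntComp_self hd hxi) k
  · have hdeep : ∀ g ∈ γ, ∀ j, (g j).natAbs + R ≤ N := fun g hg j => natAbs_add_le_of_extLabel hd hb hR hω hγ hs hg j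
    obtain ⟨g₀, hg₀⟩ := hγ.nonempty
    have hNR : R ≤ N := le_trans (Nat.le_add_left R _) (hdeep g₀ hg₀ k)
    have hγbox : γ ⊆ box d (N - R) := fun g hg => mem_box.2 fun j => by
      have := hdeep g hg j; constructor <;> omega
    have := (mem_box.1 (starInt_subset_box hd hγbox hxi)) k
    omega

/-- The oppositely labelled interior and its translate by `-b eᵢ` lie in the cube (`R ≥ b`).
[cite: VanenterFernandezSokal1993, App. B.5.3] -/
theorem mem_box_of_mem_oppSites (hd : 2 ≤ d) (hb : 2 ≤ b) (hR : 2 ≤ R) (hRb : b ≤ R) {R' : ℕ}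
    {σ : SpinConfig (Site d)} (hω : PlusOutside b (b * R') σ) {γ : Finset (Site d)} (hγ : IsContourOf b R σ γ)
    {x : Site d} (hx : x ∈ oppSites b R σ γ) (i : Fin d) :
    x ∈ box d (b * R') ∧ spShift d b (zneg i) x ∈ box d (b * R') := by
  have h := natAbs_add_le_of_mem_oppSites hd hb hR hω hγ hx
  refine ⟨mem_box.2 fun k => ?_, mem_box.2 fun k => ?_⟩
  · have := h k; constructor <;> omega
  · rw [spShift_zneg_apply]
    by_cases hk : k = i
    · subst hk; rw [Function.update_self]; have := h k; constructor <;> push_cast <;> omega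
    · rw [Function.update_of_ne hk]; have := h k; constructor <;> omega

/-- The oppositely labelled internal sites lie in the volume `Λ^int_{R'}`. [cite: VanenterFernandezSokal1993, App. B.5.3] -/
theorem oppInt_subset (hd : 2 ≤ d) (hb : 2 ≤ b) (hR : 2 ≤ R) (hRb : b ≤ R) {R' : ℕ} {σ : SpinConfig (Site d)}
    (hω : PlusOutside b (b * R') σ) {γ : Finset (Site d)} (hγ : IsContourOf b R σ γ) (i : Fin d) :
    oppInt b R σ γ ⊆ spacingIntVolume d b R' := fun x hx => by
  obtain ⟨hxo, hxi⟩ := mem_oppInt.1 hx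
  exact mem_filter.2 ⟨(mem_box_of_mem_oppSites hd hb hR hRb hω hγ hxo i).1, hxi⟩

/-- **The wrong contour sites lie in the volume**: a contour site outside the cube carries `+`, so it
is wrong only if the exterior label is `-1`, but then the contour is deep inside the cube.
[cite: VanenterFernandezSokal1993, §4.3.1 Step 2] -/
theorem wrongSites_subset (hd : 2 ≤ d) (hb : 2 ≤ b) (hR : 2 ≤ R) {R' : ℕ} {σ : SpinConfig (Site d)}
    (hω : PlusOutside b (b * R') σ) {γ : Finset (Site d)} (hγ : IsContourOf b R σ γ) :
    wrongSites b R σ γ ⊆ spacingIntVolume d b R' := fun g hg => by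
  obtain ⟨hgγ, hgi, hgσ⟩ := mem_wrongSites.1 hg
  refine mem_filter.2 ⟨?_, hgi⟩
  by_contra hgb
  have h1 : σ g = 1 := hω g hgi hgb
  rw [h1] at hgσ
  have hs : extLabel b R σ γ = -1 := by
    rcases Int.units_eq_one_or (extLabel b R σ γ) with h | h
    · rw [h] at hgσ; exact absurd hgσ (by decide)
    · exact h
  have := natAbs_add_le_of_extLabel hd hb hR hω hγ hs hgγ
  exact hgb (mem_box.2 fun j => by have := this j; constructor <;> omega)

end System

/-! ### Discharging the band hypotheses from the contour structure -/

section Bands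

variable {b R : ℕ}

/-- Sites of the interior component of a site of `oppSites` are in `oppSites`. [cite: FriedliVelenik2017, §7.2.6] -/
theorem mem_oppSites_of_mem_starIntComp (hd : 2 ≤ d) {σ : SpinConfig (Site d)} {γ : Finset (Site d)}
    {x y : Site d} (hx : x ∈ oppSites b R σ γ) (hy : y ∈ starIntComp γ x) : y ∈ oppSites b R σ γ := by
  obtain ⟨hxi, hxl⟩ := mem_oppSites.1 hx
  refine mem_oppSites.2 ⟨starIntComp_subset γ x hy, ?_⟩
  rwa [starIntComp_eq_of_mem hd hxi hy]

/-- An interior site `★`-adjacent to the contour is a collar site of its component. [cite: FriedliVelenik2017, §7.2.6] -/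
theorem mem_inBoundary_of_adj_mem (hd : 2 ≤ d) {γ : Finset (Site d)} {x y : Site d} (hx : x ∈ starInt γ)
    (hy : y ∈ γ) (hadj : (zdStar d).Adj x y) : x ∈ inBoundary (starIntComp γ x) :=
  mem_inBoundary.2 ⟨mem_starIntComp_self hd hx, y, fun h' => ((mem_starInt hd).1 (starIntComp_subset γ x h')).1 hy, hadj⟩

/-- Translation by a period preserves being internal. [cite: VanenterFernandezSokal1993, §4.3.2] -/
theorem isSpImageSite_spShift_iff (b : ℕ) (z x : Site d) : IsSpImageSite d b (spShift d b z x) ↔ IsSpImageSite d b x := by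
  rw [spShift_apply]; exact isSpImageSite_add_smul x z

/-- Translation preserves sup-distances. [folklore] -/
theorem supDist_spShift (b : ℕ) (z x y : Site d) : supDist (spShift d b z x) (spShift d b z y) = supDist x y := by
  unfold supDist
  congr 1
  funext k
  simp [spShift_apply]

/-- The translate `x - b eᵢ` is within sup-distance `b` of `x`. [folklore] -/
theorem supDist_spShift_zneg_le (b : ℕ) (i : Fin d) (x : Site d) : supDist x (spShift d b (zneg i) x) ≤ b := by
  rw [supDist_comm, spShift_zneg_apply]
  exact supDist_update_le x i _ (by omega)

-- (the sup-distance triangle inequality `supDist_triangle` is `ZdBoxesLines`'.)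

/-- **Exit towards `-eᵢ`**: if `x ∈ oppInt` but `x - b eᵢ ∉ oppInt`, a collar site of the component of
`x` lies within sup-distance `b` of `x - b eᵢ` and `b - 1` of `x`. [cite: FriedliVelenik2017, §7.2.6] -/
theorem exists_collar_of_shift_notMem (hd : 2 ≤ d) {σ : SpinConfig (Site d)} {γ : Finset (Site d)} (i : Fin d)
    {x : Site d} (hx : x ∈ oppInt b R σ γ) (hφx : spShift d b (zneg i) x ∉ oppInt b R σ γ) :
    ∃ c ∈ inBoundary (starIntComp γ x), supDist c (spShift d b (zneg i) x) ≤ b ∧ supDist c x + 1 ≤ b := by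
  obtain ⟨hxo, hxint⟩ := mem_oppInt.1 hx
  have hxi : x ∈ starInt γ := (mem_oppSites.1 hxo).1
  have hφint : ¬ IsSpImageSite d b (spShift d b (zneg i) x) := by rwa [isSpImageSite_spShift_iff]
  have hφo : spShift d b (zneg i) x ∉ oppSites b R σ γ := fun h => hφx (mem_oppInt.2 ⟨h, hφint⟩)
  have hφA : spShift d b (zneg i) x ∉ starIntComp γ x := fun h => hφo (mem_oppSites_of_mem_starIntComp hd hxo h)
  rw [spShift_zneg_apply] at hφA
  obtain ⟨t, ht1, htb, -, hc⟩ := exists_exit_collar hd hxi i (Or.inr rfl) hφA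
  refine ⟨_, hc, ?_, ?_⟩
  · rw [spShift_zneg_apply, supDist_le_iff]
    intro k
    by_cases hk : k = i
    · subst hk; simp only [Function.update_self]; omega
    · simp only [Function.update_of_ne hk]; simp
  · have : supDist (Function.update x i (x i + ((t - 1 : ℕ) : ℤ) * (-1))) x ≤ t - 1 :=
      supDist_update_le x i _ (by omega)
    omega

/-- **Exit towards `+eᵢ`**: if `x ∈ oppInt` is not the translate of a site of `oppInt`, a collar site
of the component of `x` lies within sup-distance `b - 1` of `x`. [cite: FriedliVelenik2017, §7.2.6] -/
theorem exists_collar_of_notMem_image (hd : 2 ≤ d) {σ : SpinConfig (Site d)} {γ : Finset (Site d)}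
    (i : Fin d) {x : Site d} (hx : x ∈ oppInt b R σ γ)
    (hx' : x ∉ (oppInt b R σ γ).image (spShift d b (zneg i))) :
    ∃ c ∈ inBoundary (starIntComp γ x), supDist c x + 1 ≤ b := by
  classical
  obtain ⟨hxo, hxint⟩ := mem_oppInt.1 hx
  have hxi : x ∈ starInt γ := (mem_oppSites.1 hxo).1
  set y : Site d := Function.update x i (x i + (b : ℕ) * (1 : ℤ)) with hy
  have hφy : spShift d b (zneg i) y = x := spShift_zneg_update_add b i x
  have hyI : y ∉ oppInt b R σ γ := fun h => hx' (mem_image.2 ⟨y, h, hφy⟩)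
  have hyint : ¬ IsSpImageSite d b y := by
    rw [← isSpImageSite_spShift_iff b (zneg i), hφy]; exact hxint
  have hyo : y ∉ oppSites b R σ γ := fun h => hyI (mem_oppInt.2 ⟨h, hyint⟩)
  have hyA : y ∉ starIntComp γ x := fun h => hyo (mem_oppSites_of_mem_starIntComp hd hxo h)
  obtain ⟨t, ht1, htb, -, hc⟩ := exists_exit_collar hd hxi i (Or.inl rfl) (m := b) (by rwa [hy] at hyA)
  refine ⟨_, hc, ?_⟩
  have : supDist (Function.update x i (x i + ((t - 1 : ℕ) : ℤ) * 1)) x ≤ t - 1 :=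
    supDist_update_le x i _ (by omega)
  omega

/-- **The erased configuration agrees with `σ` off the wrong sites and the oppositely labelled
interior.** [cite: VanenterFernandezSokal1993, App. B.5.3] -/
theorem eraseContour_apply_of_notMem {σ : SpinConfig (Site d)} {γ : Finset (Site d)} (i : Fin d) {u : Site d}
    (hN : u ∉ wrongSites b R σ γ) (hI : u ∉ oppInt b R σ γ) : eraseContour b R i σ γ u = σ u := by
  rw [eraseContour, flipOn_apply_of_notMem _ hN, flipShift_of_notMem _ _ hI]

/-- The erased configuration agrees with `σ` off the volume (so it is a configuration of the same
finite-volume system). [cite: VanenterFernandezSokal1993, App. B.5.3] -/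
theorem eraseContour_apply_of_notMem_volume (hd : 2 ≤ d) (hb : 2 ≤ b) (hR : 2 ≤ R) (hRb : b ≤ R) {p : ℤˣ}
    {R' : ℕ} {σ : SpinConfig (Site d)} (hσ : ∀ x, x ∉ spacingIntVolume d b R' → σ x = signedCoreAnnulusBC d b p R' R' 1 1 x)
    {γ : Finset (Site d)} (hγ : IsContourOf b R σ γ) (i : Fin d) {u : Site d} (hu : u ∉ spacingIntVolume d b R') :
    eraseContour b R i σ γ u = signedCoreAnnulusBC d b p R' R' 1 1 u := by
  have hω := plusOutside_of_eqOn hσ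
  rw [eraseContour_apply_of_notMem i (fun h => hu (wrongSites_subset hd hb hR hω hγ h))
    (fun h => hu (oppInt_subset hd hb hR hRb hω hγ i h)), hσ u hu]

/-- **The energy released by erasing a contour** of a configuration of the system
`⟨Λ^int_{R'}; p·ω'_alt; +⟩` (goodness radius `R ≥ b + 1`): the relative energy (B.71) of the island
`M = wrongSites ∪ oppInt` in the ground state labelled by the exterior label,
`ℋ(σ) - ℋ(erase σ) = 2·#ffBdryPairs M + 2s·∑_{u ∈ M} h_u` (`s` the exterior label). All band
hypotheses of Lemma A and Lemma B follow from the typing of the collars.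
[cite: VanenterFernandezSokal1993, App. B.5.3 eq. (B.71); FriedliVelenik2017, §7.2.6] -/
theorem fieldHamiltonian_sub_eraseContour (hd : 2 ≤ d) (hb : 2 ≤ b) (hRb : b + 1 ≤ R) {p : ℤˣ} {R' : ℕ}
    {σ : SpinConfig (Site d)} (hσ : ∀ x, x ∉ spacingIntVolume d b R' → σ x = signedCoreAnnulusBC d b p R' R' 1 1 x)
    {γ : Finset (Site d)} (hγ : IsContourOf b R σ γ) (i : Fin d) :
    fieldHamiltonian (spDilutedGraph d b) (spacingIntVolume d b R') (imgField d b (signedCoreAnnulusBC d b p R' R' 1 1))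
        (.fixed (signedCoreAnnulusBC d b p R' R' 1 1)) σ -
      fieldHamiltonian (spDilutedGraph d b) (spacingIntVolume d b R') (imgField d b (signedCoreAnnulusBC d b p R' R' 1 1))
        (.fixed (signedCoreAnnulusBC d b p R' R' 1 1)) (eraseContour b R i σ γ) =
      2 * #(ffBdryPairs d b (wrongSites b R σ γ ∪ oppInt b R σ γ)) +
        2 * ((extLabel b R σ γ : ℤ) : ℝ) *
          ∑ u ∈ wrongSites b R σ γ ∪ oppInt b R σ γ, imgField d b (signedCoreAnnulusBC d b p R' R' 1 1) u := by
  classical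
  have hR : 2 ≤ R := by omega
  have hRb' : b ≤ R := by omega
  have hR1 : 1 ≤ R := by omega
  set ζ := signedCoreAnnulusBC d b p R' R' 1 1 with hζ
  set s := extLabel b R σ γ with hs
  set I := oppInt b R σ γ with hI
  set N := wrongSites b R σ γ with hN
  set φ := spShift d b (zneg i) with hφ
  have hω : PlusOutside b (b * R') σ := plusOutside_of_eqOn hσ
  -- spins near collars of oppositely labelled components
  have hopp : ∀ {x c v : Site d}, x ∈ I → c ∈ inBoundary (starIntComp γ x) → supDist c v ≤ R →
      ¬ IsSpImageSite d b v → σ v = -s := fun hx hc hcv hvi =>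
    apply_eq_neg_extLabel_of_opp hd hb hR hγ (mem_oppInt.1 hx).1 hc (mem_ball_iff_supDist.2 hcv) hvi
  have hIint : ∀ x ∈ I, ¬ IsSpImageSite d b x := fun x hx => (mem_oppInt.1 hx).2
  have hNint : ∀ y ∈ N, ¬ IsSpImageSite d b y := fun y hy => (mem_wrongSites.1 hy).2.1
  have hφint : ∀ x, ¬ IsSpImageSite d b x → ¬ IsSpImageSite d b (φ x) := fun x hx => by
    rw [hφ, isSpImageSite_spShift_iff]; exact hx
  -- an internal neighbour of `I` outside `I` is on the contour, and the `I`-site is a collar site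
  have hnbr : ∀ x ∈ I, ∀ y ∉ I, (spDilutedGraph d b).Adj x y →
      y ∈ γ ∧ x ∈ inBoundary (starIntComp γ x) := by
    intro x hx y hy hadj
    have hxo := (mem_oppInt.1 hx).1
    have hyo : y ∉ oppSites b R σ γ := fun h => hy (mem_oppInt.2 ⟨h, hadj.2.2⟩)
    have hadj' : (zdStar d).Adj x y := zdGraph_le_zdStar hadj.1
    have hyγ : y ∈ γ := mem_of_adj_oppSites hd hxo hyo hadj'
    exact ⟨hyγ, mem_inBoundary_of_adj_mem hd (mem_oppSites.1 hxo).1 hyγ hadj'⟩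
  have hadj_dist : ∀ {x y : Site d}, (spDilutedGraph d b).Adj x y → supDist x y ≤ 1 := fun hadj =>
    (zdStar_adj.1 (zdGraph_le_zdStar hadj.1)).2
  -- (hC)
  have hC : ∀ x ∈ I, ∀ y ∉ I, (spDilutedGraph d b).Adj x y → σ (φ x) = σ x ∧ σ y = σ x := by
    intro x hx y hy hadj
    obtain ⟨-, hxc⟩ := hnbr x hx y hy hadj
    have h1 : σ x = -s := hopp hx hxc (by simp) (hIint x hx)
    have h2 : σ (φ x) = -s := hopp hx hxc ((supDist_spShift_zneg_le b i x).trans hRb') (hφint x (hIint x hx))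
    have h3 : σ y = -s := hopp hx hxc ((hadj_dist hadj).trans hR1) hadj.2.2
    rw [h1, h2, h3]; exact ⟨rfl, rfl⟩
  -- (hIN)
  have hIN : ∀ x ∈ I, ∀ y ∉ I, (spDilutedGraph d b).Adj x y → y ∈ N := by
    intro x hx y hy hadj
    obtain ⟨hyγ, hxc⟩ := hnbr x hx y hy hadj
    exact mem_wrongSites.2 ⟨hyγ, hadj.2.2, hopp hx hxc ((hadj_dist hadj).trans hR1) hadj.2.2⟩
  -- (hB1), (hB2)
  have hB1 : ∀ x ∈ I, φ x ∉ I → σ (φ x) = -s := by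
    intro x hx hφx
    obtain ⟨c, hc, hcφ, -⟩ := exists_collar_of_shift_notMem hd i hx hφx
    exact hopp hx hc (hcφ.trans hRb') (hφint x (hIint x hx))
  have hB2 : ∀ x ∈ I, x ∉ I.image φ → σ x = -s := by
    intro x hx hx'
    obtain ⟨c, hc, hcx⟩ := exists_collar_of_notMem_image hd i hx hx'
    exact hopp hx hc (by omega) (hIint x hx)
  -- (hBA), (hBB)
  have hBA : ∀ x ∈ I, ∀ y ∈ I, (spDilutedGraph d b).Adj x y → (x ∉ I.image φ ∨ y ∉ I.image φ) → σ x = σ y := by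
    intro x hx y hy hadj hor
    rcases hor with hx' | hy'
    · obtain ⟨c, hc, hcx⟩ := exists_collar_of_notMem_image hd i hx hx'
      have hcy : supDist c y ≤ R := (supDist_triangle c x y).trans (by have := hadj_dist hadj; omega)
      rw [hopp hx hc (by omega) (hIint x hx), hopp hx hc hcy (hIint y hy)]
    · obtain ⟨c, hc, hcy⟩ := exists_collar_of_notMem_image hd i hy hy'
      have hcx : supDist c x ≤ R :=
        (supDist_triangle c y x).trans (by have := hadj_dist hadj; rw [supDist_comm] at this; omega)
      rw [hopp hy hc (by omega) (hIint y hy), hopp hy hc hcx (hIint x hx)]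
  have hBB : ∀ x ∈ I, ∀ y ∈ I, (spDilutedGraph d b).Adj x y → (φ x ∉ I ∨ φ y ∉ I) → σ (φ x) = σ (φ y) := by
    intro x hx y hy hadj hor
    have hxy1 : supDist (φ x) (φ y) ≤ 1 := by rw [hφ, supDist_spShift]; exact hadj_dist hadj
    rcases hor with hx' | hy'
    · obtain ⟨c, hc, hcφ, -⟩ := exists_collar_of_shift_notMem hd i hx hx'
      have hcφ' : supDist c (φ x) ≤ b := hcφ
      have hcy : supDist c (φ y) ≤ R := (supDist_triangle c (φ x) (φ y)).trans (by omega)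
      rw [hopp hx hc (hcφ'.trans hRb') (hφint x (hIint x hx)), hopp hx hc hcy (hφint y (hIint y hy))]
    · obtain ⟨c, hc, hcφ, -⟩ := exists_collar_of_shift_notMem hd i hy hy'
      have hcφ' : supDist c (φ y) ≤ b := hcφ
      have hyx1 : supDist (φ y) (φ x) ≤ 1 := by rw [supDist_comm]; exact hxy1
      have hcx : supDist c (φ x) ≤ R := (supDist_triangle c (φ y) (φ x)).trans (by omega)
      rw [hopp hy hc (hcφ'.trans hRb') (hφint y (hIint y hy)), hopp hy hc hcx (hφint x (hIint x hx))]
  -- (hout): internal neighbours of the wrong sites outside them carry `s` after the flip∘shift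
  have hout : ∀ y ∈ N, ∀ w ∉ N, (spDilutedGraph d b).Adj y w → flipShift I φ σ w = -(-s) := by
    intro y hy w hw hadj
    rw [neg_neg]
    obtain ⟨hyγ, hyint, hyσ⟩ := mem_wrongSites.1 hy
    have hwint : ¬ IsSpImageSite d b w := hadj.2.2
    have hadj' : (zdStar d).Adj w y := zdGraph_le_zdStar hadj.1.symm
    by_cases hwI : w ∈ I
    · rw [flipShift_of_mem _ _ hwI]
      have hwo := (mem_oppInt.1 hwI).1
      have hwc : w ∈ inBoundary (starIntComp γ w) := mem_inBoundary_of_adj_mem hd (mem_oppSites.1 hwo).1 hyγ hadj'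
      rw [hopp hwI hwc ((supDist_spShift_zneg_le b i w).trans hRb') (hφint w hwint), neg_neg]
    rw [flipShift_of_notMem _ _ hwI]
    by_cases hwγ : w ∈ γ
    · have : σ w ≠ -s := fun h => hw (mem_wrongSites.2 ⟨hwγ, hwint, h⟩)
      rw [units_eq_neg_of_ne this, neg_neg]
    rcases mem_starExt_or_mem_starInt hd hwγ with hwe | hwi
    · have hwB : w ∈ exBoundary (starHullFinset γ) :=
        mem_exBoundary.2 ⟨fun h => ((mem_starHullFinset hd).1 h) hwe, y,
          (mem_starHullFinset hd).2 (subset_starHull γ (mem_coe.2 hyγ)), hadj'.symm⟩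
      exact apply_eq_extLabel_of_mem_ball_exBoundary hd hb hR hγ hwB (mem_ball_self R w) hwint
    · have hwc : w ∈ inBoundary (starIntComp γ w) := mem_inBoundary_of_adj_mem hd hwi hyγ hadj'
      rw [apply_eq_compLabel_of_mem_ball_inBoundary hd hb hR hγ hwi hwc (mem_ball_self R w) hwint]
      by_contra hne
      exact hwI (mem_oppInt.2 ⟨mem_oppSites.2 ⟨hwi, hne⟩, hwint⟩)
  -- assemble with the abstract erasure identity
  have hALT : ∀ x ∈ I, imgField d b ζ (φ x) = -imgField d b ζ x := fun x hx => by
    obtain ⟨h1, h2⟩ := mem_box_of_mem_oppSites hd hb hR hRb' hω hγ (mem_oppInt.1 hx).1 i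
    exact imgField_spShift_zneg hb p R' i h1 h2
  have hNI : Disjoint N I := Finset.disjoint_left.2 fun g hgN hgI =>
    ((mem_starInt hd).1 (mem_oppSites.1 (mem_oppInt.1 hgI).1).1).1 (mem_wrongSites.1 hgN).1
  have key := fieldHamiltonian_sub_erase (zneg i) (oppInt_subset hd hb hR hRb' hω hγ i) (wrongSites_subset hd hb hR hω hγ)
    hNI hNint hIint (imgField d b ζ) hALT (t := -s) hB1 hB2 hBA hBB hC hIN (fun y hy => (mem_wrongSites.1 hy).2.2) hout ζ
  rw [eraseContour, key, Units.val_neg, Int.cast_neg]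
  ring

end Bands

/-! ### The released energy is at least the contour size divided by the ball volume -/

section Energy

variable {b R : ℕ}

/-- **Erasing a contour releases at least the area of its island**:
`ℋ^ζ_{Λ^int_{R'}}(σ) - ℋ^ζ_{Λ^int_{R'}}(erase σ) ≥ #ffBdryPairs(wrongSites ∪ oppInt)` (zero field, units
`J = 1`), by the erasure identity and the tree's Peierls condition for the pattern of parity `p`
(exterior label `+`) or `-p` (exterior label `-`, whose island is a `+` island of the opposite
ground state). [cite: VanenterFernandezSokal1993, App. B.5.3 eqs. (B.71)–(B.77)] -/
theorem card_ffBdryPairs_le_isingHamiltonian_sub_eraseContour (hd : 2 ≤ d) (hb : 2 ≤ b) (hRb : b + 1 ≤ R)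
    {p : ℤˣ} {R' : ℕ} {σ : SpinConfig (Site d)}
    (hσ : ∀ x, x ∉ spacingIntVolume d b R' → σ x = signedCoreAnnulusBC d b p R' R' 1 1 x)
    {γ : Finset (Site d)} (hγ : IsContourOf b R σ γ) (i : Fin d) :
    (#(ffBdryPairs d b (wrongSites b R σ γ ∪ oppInt b R σ γ)) : ℝ) ≤
      isingHamiltonian (zdGraph d) (spacingIntVolume d b R') 0 (.fixed (signedCoreAnnulusBC d b p R' R' 1 1)) σ -
        isingHamiltonian (zdGraph d) (spacingIntVolume d b R') 0 (.fixed (signedCoreAnnulusBC d b p R' R' 1 1))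
          (eraseContour b R i σ γ) := by
  have hR : 2 ≤ R := by omega
  have hRb' : b ≤ R := by omega
  have hΛint : ∀ x ∈ spacingIntVolume d b R', ¬ IsSpImageSite d b x := fun x hx =>
    not_isSpImageSite_of_mem_spacingIntVolume hx
  have hω := plusOutside_of_eqOn hσ
  rw [isingHamiltonian_zd_eq_fieldHamiltonian_spDiluted hΛint _ σ hσ,
    isingHamiltonian_zd_eq_fieldHamiltonian_spDiluted hΛint _ (eraseContour b R i σ γ)
      (fun x hx => eraseContour_apply_of_notMem_volume hd hb hR hRb' hσ hγ i hx),
    fieldHamiltonian_sub_eraseContour hd hb hRb hσ hγ i]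
  set M := wrongSites b R σ γ ∪ oppInt b R σ γ with hM
  have hMbox : ∀ u ∈ M, u ∈ box d (b * R') := fun u hu => by
    rcases mem_union.1 hu with h | h
    · exact mem_box_of_mem_spacingIntVolume (wrongSites_subset hd hb hR hω hγ h)
    · exact mem_box_of_mem_spacingIntVolume (oppInt_subset hd hb hR hRb' hω hγ i h)
  rcases Int.units_eq_one_or (extLabel b R σ γ) with hs | hs
  · -- exterior label `+`: a `-` island in `ω^{(+)}`, Peierls condition for the pattern itself
    have h := card_ffBdryPairs_le_of_peierls hd hb (M := M) (t := -1) (ζ := signedCoreAnnulusBC d b p R' R' 1 1)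
      (minusIsolated_signedCoreAnnulusBC (by omega) p R') (fun u _ => by push_cast; ring)
    rw [hs]; push_cast at h ⊢; linarith
  · -- exterior label `-`: a `+` island in `ω^{(-)}`, Peierls condition for the opposite parity
    have h := card_ffBdryPairs_le_of_peierls hd hb (M := M) (t := 1) (ζ := signedCoreAnnulusBC d b p R' R' 1 1)
      (minusIsolated_signedCoreAnnulusBC (by omega) (-p) R')
      (fun u hu => by rw [imgField_signedCoreAnnulusBC_neg_parity hb p R' (hMbox u hu)]; push_cast; ring)
    rw [hs]; push_cast at h ⊢; linarith

/-- **On the ball of a contour site, the island is exactly the set of internal spins opposite to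
the exterior label.** [cite: FriedliVelenik2017, §7.2.6, Lemma 7.19] -/
theorem mem_island_iff_of_mem_ball (hd : 2 ≤ d) (hb : 2 ≤ b) (hR : 2 ≤ R) {σ : SpinConfig (Site d)}
    {γ : Finset (Site d)} (hγ : IsContourOf b R σ γ) {g : Site d} (hg : g ∈ γ) {v : Site d} (hv : v ∈ ball R g)
    (hvi : ¬ IsSpImageSite d b v) :
    v ∈ wrongSites b R σ γ ∪ oppInt b R σ γ ↔ σ v = -extLabel b R σ γ := by
  have hdist : supDist g v ≤ R := mem_ball_iff_supDist.1 hv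
  rw [mem_union, mem_wrongSites, mem_oppInt, mem_oppSites]
  constructor
  · rintro (⟨-, -, h⟩ | ⟨⟨hvi', hne⟩, -⟩)
    · exact h
    · rw [apply_eq_compLabel_of_near hd hb hR hγ hg hvi' hdist hvi]
      exact units_eq_neg_of_ne hne
  · intro h
    by_cases hvγ : v ∈ γ
    · exact Or.inl ⟨hvγ, hvi, h⟩
    · right
      rcases mem_starExt_or_mem_starInt hd hvγ with hve | hvi'
      · rw [apply_eq_extLabel_of_near hd hb hR hγ hg hve hdist hvi] at h
        exact absurd h (units_ne_neg_self _)
      · refine ⟨⟨hvi', fun heq => ?_⟩, hvi⟩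
        rw [apply_eq_compLabel_of_near hd hb hR hγ hg hvi' hdist hvi, heq] at h
        exact units_ne_neg_self _ h

/-- **Every contour site sees a boundary pair of the island in its ball.**
[cite: VanenterFernandezSokal1993, App. B.5.3; FriedliVelenik2017, §7.2.6] -/
theorem exists_ffBdryPair_near (hd : 2 ≤ d) (hb : 2 ≤ b) (hR : 2 ≤ R) {σ : SpinConfig (Site d)}
    {γ : Finset (Site d)} (hγ : IsContourOf b R σ γ) {g : Site d} (hg : g ∈ γ) :
    ∃ q ∈ ffBdryPairs d b (wrongSites b R σ γ ∪ oppInt b R σ γ), q.1 ∈ ball R g := by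
  obtain ⟨x, y, hxy, hx, hy, hxi, hyi, hne⟩ := exists_adj_ne_of_not_isGood hd hb (by omega) (hγ.bad g hg)
  set M := wrongSites b R σ γ ∪ oppInt b R σ γ
  by_cases hσx : σ x = -extLabel b R σ γ
  · refine ⟨(x, y), mem_ffBdryPairs.2 ⟨(mem_island_iff_of_mem_ball hd hb hR hγ hg hx hxi).2 hσx,
      fun h => hne ?_, hyi, hxy⟩, hx⟩
    rw [hσx, (mem_island_iff_of_mem_ball hd hb hR hγ hg hy hyi).1 h]
  · have hσx' : σ x = extLabel b R σ γ := by
      by_contra h; exact hσx (units_eq_neg_of_ne h)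
    have hσy : σ y = -extLabel b R σ γ := by
      rw [← hσx']; exact units_eq_neg_of_ne (Ne.symm hne)
    refine ⟨(y, x), mem_ffBdryPairs.2 ⟨(mem_island_iff_of_mem_ball hd hb hR hγ hg hy hyi).2 hσy,
      fun h => hσx ((mem_island_iff_of_mem_ball hd hb hR hγ hg hx hxi).1 h), hxi, hxy.symm⟩, hy⟩

/-- **The contour is at most `(2R+1)^d` times the area of its island.**
[cite: VanenterFernandezSokal1993, App. B.5.3 (thick vs thin contours); FriedliVelenik2017, §7.2.6] -/
theorem card_le_mul_card_ffBdryPairs (hd : 2 ≤ d) (hb : 2 ≤ b) (hR : 2 ≤ R) {σ : SpinConfig (Site d)}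
    {γ : Finset (Site d)} (hγ : IsContourOf b R σ γ) :
    #γ ≤ (2 * R + 1) ^ d * #(ffBdryPairs d b (wrongSites b R σ γ ∪ oppInt b R σ γ)) := by
  classical
  set M := wrongSites b R σ γ ∪ oppInt b R σ γ with hM
  -- choose a boundary pair near each contour site
  have hch : ∀ g : Site d, ∃ q : Site d × Site d, g ∈ γ → q ∈ ffBdryPairs d b M ∧ q.1 ∈ ball R g := by
    intro g
    by_cases hg : g ∈ γ
    · obtain ⟨q, hq, hq1⟩ := exists_ffBdryPair_near hd hb hR hγ hg
      exact ⟨q, fun _ => ⟨hq, hq1⟩⟩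
    · exact ⟨(g, g), fun h => absurd h hg⟩
  choose f hf using hch
  have himg : γ.image f ⊆ ffBdryPairs d b M := by
    intro q hq
    obtain ⟨g, hg, rfl⟩ := mem_image.1 hq
    exact (hf g hg).1
  have hfib : ∀ q ∈ γ.image f, #(γ.filter fun g => f g = q) ≤ (2 * R + 1) ^ d := by
    intro q _
    rw [← card_ball R q.1]
    refine card_le_card fun g hg => ?_
    obtain ⟨hgγ, hgq⟩ := mem_filter.1 hg
    have := (hf g hgγ).2
    rw [hgq] at this
    exact mem_ball_comm.1 this
  calc #γ ≤ (2 * R + 1) ^ d * #(γ.image f) := card_le_mul_card_image _ _ hfib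
    _ ≤ (2 * R + 1) ^ d * #(ffBdryPairs d b M) := Nat.mul_le_mul_left _ (card_le_card himg)

/-- **The energy bound of the Peierls argument**: erasing a contour `γ` lowers the energy by at
least `#γ / (2R+1)^d`. [cite: VanenterFernandezSokal1993, App. B.5.3; FriedliVelenik2017, §3.7.2 eq. (3.37)] -/
theorem card_div_le_isingHamiltonian_sub_eraseContour (hd : 2 ≤ d) (hb : 2 ≤ b) (hRb : b + 1 ≤ R)
    {p : ℤˣ} {R' : ℕ} {σ : SpinConfig (Site d)}
    (hσ : ∀ x, x ∉ spacingIntVolume d b R' → σ x = signedCoreAnnulusBC d b p R' R' 1 1 x)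
    {γ : Finset (Site d)} (hγ : IsContourOf b R σ γ) (i : Fin d) :
    (#γ : ℝ) / (2 * R + 1) ^ d ≤
      isingHamiltonian (zdGraph d) (spacingIntVolume d b R') 0 (.fixed (signedCoreAnnulusBC d b p R' R' 1 1)) σ -
        isingHamiltonian (zdGraph d) (spacingIntVolume d b R') 0 (.fixed (signedCoreAnnulusBC d b p R' R' 1 1))
          (eraseContour b R i σ γ) := by
  have h1 := card_ffBdryPairs_le_isingHamiltonian_sub_eraseContour hd hb hRb hσ hγ i
  have h2 := card_le_mul_card_ffBdryPairs hd hb (by omega) hγ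
  have h2' : (#γ : ℝ) ≤ (2 * R + 1) ^ d * #(ffBdryPairs d b (wrongSites b R σ γ ∪ oppInt b R σ γ)) := by
    exact_mod_cast h2
  have hpos : (0 : ℝ) < (2 * R + 1) ^ d := by positivity
  rw [div_le_iff₀ hpos]
  nlinarith

end Energy

/-! ### The erasure is injective given the contour and the configuration near it -/

section Injective

variable {b R : ℕ}

/-- The label at `u` depends only on the configuration on `ball R u`. [folklore] -/
theorem label_congr {σ₁ σ₂ : SpinConfig (Site d)} {u : Site d} (h : ∀ v ∈ ball R u, σ₁ v = σ₂ v) :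
    label b R σ₁ u = label b R σ₂ u := by
  unfold label
  have : (∀ v ∈ ball R u, ¬ IsSpImageSite d b v → σ₁ v = 1) ↔ (∀ v ∈ ball R u, ¬ IsSpImageSite d b v → σ₂ v = 1) :=
    ⟨fun H v hv hvi => by rw [← h v hv]; exact H v hv hvi, fun H v hv hvi => by rw [h v hv]; exact H v hv hvi⟩
  simp only [this]

/-- The `(R+1)`-neighbourhood of `γ` contains the `R`-ball of every site `★`-adjacent to `γ`. [folklore] -/
theorem ball_subset_biUnion_of_adj {γ : Finset (Site d)} {g c : Site d} (hg : g ∈ γ) (hgc : (zdStar d).Adj g c) :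
    ball R c ⊆ γ.biUnion (ball (R + 1)) := fun v hv =>
  mem_biUnion.2 ⟨g, hg, by
    have := mem_ball_add (mem_ball_of_adj (le_refl 1) hgc) hv
    rwa [add_comm] at this⟩

/-- The exterior label depends only on the configuration on the `(R+1)`-neighbourhood of the
contour. [cite: FriedliVelenik2017, §7.2.6] -/
theorem extLabel_congr (hd : 2 ≤ d) {σ₁ σ₂ : SpinConfig (Site d)} {γ : Finset (Site d)}
    (h : ∀ v ∈ γ.biUnion (ball (R + 1)), σ₁ v = σ₂ v) : extLabel b R σ₁ γ = extLabel b R σ₂ γ := by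
  unfold extLabel
  have key : ∀ c ∈ exBoundary (starHullFinset γ), label b R σ₁ c = label b R σ₂ c := fun c hc => by
    obtain ⟨-, g, hg, hgc⟩ := exists_adj_of_mem_exBoundary_hull hd hc
    exact label_congr fun v hv => h v (ball_subset_biUnion_of_adj hg hgc hv)
  have : (∃ c ∈ exBoundary (starHullFinset γ), label b R σ₁ c = 1) ↔
      (∃ c ∈ exBoundary (starHullFinset γ), label b R σ₂ c = 1) :=
    ⟨fun ⟨c, hc, h1⟩ => ⟨c, hc, (key c hc) ▸ h1⟩, fun ⟨c, hc, h1⟩ => ⟨c, hc, (key c hc).symm ▸ h1⟩⟩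
  simp only [this]

/-- The label of an interior component depends only on the configuration on the
`(R+1)`-neighbourhood of the contour. [cite: FriedliVelenik2017, §7.2.6] -/
theorem compLabel_congr_of_eqOn (hd : 2 ≤ d) {σ₁ σ₂ : SpinConfig (Site d)} {γ : Finset (Site d)}
    (h : ∀ v ∈ γ.biUnion (ball (R + 1)), σ₁ v = σ₂ v) {x : Site d} (hx : x ∈ starInt γ) :
    compLabel b R σ₁ (starIntComp γ x) = compLabel b R σ₂ (starIntComp γ x) := by
  unfold compLabel
  have key : ∀ c ∈ inBoundary (starIntComp γ x), label b R σ₁ c = label b R σ₂ c := fun c hc => by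
    obtain ⟨-, g, hg, hgc⟩ := exists_adj_of_mem_inBoundary_comp hd hx hc
    exact label_congr fun v hv => h v (ball_subset_biUnion_of_adj hg hgc hv)
  have : (∃ c ∈ inBoundary (starIntComp γ x), label b R σ₁ c = 1) ↔
      (∃ c ∈ inBoundary (starIntComp γ x), label b R σ₂ c = 1) :=
    ⟨fun ⟨c, hc, h1⟩ => ⟨c, hc, (key c hc) ▸ h1⟩, fun ⟨c, hc, h1⟩ => ⟨c, hc, (key c hc).symm ▸ h1⟩⟩
  simp only [this]

/-- `oppSites` depends only on the configuration near the contour. [cite: FriedliVelenik2017, §7.2.6] -/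
theorem oppSites_congr (hd : 2 ≤ d) {σ₁ σ₂ : SpinConfig (Site d)} {γ : Finset (Site d)}
    (h : ∀ v ∈ γ.biUnion (ball (R + 1)), σ₁ v = σ₂ v) : oppSites b R σ₁ γ = oppSites b R σ₂ γ := by
  ext x
  rw [mem_oppSites, mem_oppSites, extLabel_congr hd h]
  constructor
  · rintro ⟨hx, hne⟩; exact ⟨hx, by rwa [← compLabel_congr_of_eqOn hd h hx]⟩
  · rintro ⟨hx, hne⟩; exact ⟨hx, by rwa [compLabel_congr_of_eqOn hd h hx]⟩

/-- `oppInt` depends only on the configuration near the contour. [cite: FriedliVelenik2017, §7.2.6] -/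
theorem oppInt_congr (hd : 2 ≤ d) {σ₁ σ₂ : SpinConfig (Site d)} {γ : Finset (Site d)}
    (h : ∀ v ∈ γ.biUnion (ball (R + 1)), σ₁ v = σ₂ v) : oppInt b R σ₁ γ = oppInt b R σ₂ γ := by
  rw [oppInt, oppInt, oppSites_congr hd h]

/-- `wrongSites` depends only on the configuration near the contour. [cite: FriedliVelenik2017, §7.2.6] -/
theorem wrongSites_congr (hd : 2 ≤ d) {σ₁ σ₂ : SpinConfig (Site d)} {γ : Finset (Site d)}
    (h : ∀ v ∈ γ.biUnion (ball (R + 1)), σ₁ v = σ₂ v) : wrongSites b R σ₁ γ = wrongSites b R σ₂ γ := by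
  ext g
  rw [mem_wrongSites, mem_wrongSites, extLabel_congr hd h]
  constructor
  · rintro ⟨hg, hgi, hσ⟩
    exact ⟨hg, hgi, by rwa [← h g (mem_biUnion.2 ⟨g, hg, mem_ball_self _ g⟩)]⟩
  · rintro ⟨hg, hgi, hσ⟩
    exact ⟨hg, hgi, by rwa [h g (mem_biUnion.2 ⟨g, hg, mem_ball_self _ g⟩)]⟩

/-- **Injectivity of the erasure**: two configurations of the system with the same contour `γ`,
agreeing on the `(R+1)`-neighbourhood of `γ` and having the same erasure, are equal — off the
island nothing was changed, on the contour they agree, and on the oppositely labelled interior the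
spin is read off from the erasure one period away (or is the known collar value).
[cite: FriedliVelenik2017, §3.7.2 (Peierls: the flip is a bijection given the contour); VanenterFernandezSokal1993, App. B.5.3] -/
theorem eq_of_eraseContour_eq (hd : 2 ≤ d) (hb : 2 ≤ b) (hRb : b + 1 ≤ R) {σ₁ σ₂ : SpinConfig (Site d)}
    {γ : Finset (Site d)} (hγ₁ : IsContourOf b R σ₁ γ) (hγ₂ : IsContourOf b R σ₂ γ) (i : Fin d)
    (hK : ∀ v ∈ γ.biUnion (ball (R + 1)), σ₁ v = σ₂ v)
    (hE : eraseContour b R i σ₁ γ = eraseContour b R i σ₂ γ) : σ₁ = σ₂ := by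
  classical
  have hR : 2 ≤ R := by omega
  have hI : oppInt b R σ₁ γ = oppInt b R σ₂ γ := oppInt_congr hd hK
  have hN : wrongSites b R σ₁ γ = wrongSites b R σ₂ γ := wrongSites_congr hd hK
  have hs : extLabel b R σ₁ γ = extLabel b R σ₂ γ := extLabel_congr hd hK
  set I := oppInt b R σ₁ γ
  set N := wrongSites b R σ₁ γ
  set φ := spShift d b (zneg i) with hφ
  funext u
  by_cases huI : u ∈ I
  · -- on the oppositely labelled interior
    have huo := (mem_oppInt.1 huI).1
    have huint := (mem_oppInt.1 huI).2
    set y : Site d := Function.update u i (u i + (b : ℕ) * (1 : ℤ)) with hy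
    have hφy : φ y = u := spShift_zneg_update_add b i u
    by_cases hyI : y ∈ I
    · -- read the spin one period away from the erasure
      have hyγ : y ∉ γ := ((mem_starInt hd).1 (mem_oppSites.1 (mem_oppInt.1 hyI).1).1).1
      have hyN₁ : y ∉ N := fun h => hyγ (mem_wrongSites.1 h).1
      have hyN₂ : y ∉ wrongSites b R σ₂ γ := by rw [← hN]; exact hyN₁
      have hyI₂ : y ∈ oppInt b R σ₂ γ := by rw [← hI]; exact hyI
      have e1 : eraseContour b R i σ₁ γ y = -σ₁ u := by
        rw [eraseContour, flipOn_apply_of_notMem _ hyN₁, flipShift_of_mem _ _ hyI, hφy]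
      have e2 : eraseContour b R i σ₂ γ y = -σ₂ u := by
        rw [eraseContour, flipOn_apply_of_notMem _ hyN₂, flipShift_of_mem _ _ hyI₂, hφy]
      have := congrFun hE y
      rw [e1, e2] at this
      exact neg_inj.1 this
    · -- a collar value
      have hu' : u ∉ I.image φ := fun h => by
        obtain ⟨w, hw, hwu⟩ := mem_image.1 h
        have : w = y := by
          apply (spShift d b (zneg i)).injective
          rw [hwu, hφy]
        exact hyI (this ▸ hw)
      obtain ⟨c, hc, hcu⟩ := exists_collar_of_notMem_image hd i huI hu'
      have huo₂ : u ∈ oppSites b R σ₂ γ := by rw [← oppSites_congr hd hK]; exact huo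
      have hcu' : u ∈ ball R c := mem_ball_iff_supDist.2 (by omega)
      rw [apply_eq_neg_extLabel_of_opp hd hb hR hγ₁ huo hc hcu' huint,
        apply_eq_neg_extLabel_of_opp hd hb hR hγ₂ huo₂ hc hcu' huint, hs]
  · by_cases huN : u ∈ N
    · exact hK u (mem_biUnion.2 ⟨u, (mem_wrongSites.1 huN).1, mem_ball_self _ u⟩)
    · have e1 := eraseContour_apply_of_notMem i huN huI
      have huN₂ : u ∉ wrongSites b R σ₂ γ := by rw [← hN]; exact huN
      have huI₂ : u ∉ oppInt b R σ₂ γ := by rw [← hI]; exact huI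
      have e2 := eraseContour_apply_of_notMem i huN₂ huI₂
      rw [← e1, ← e2, hE]

end Injective

/-! ### The Peierls estimate: finite sums over configurations -/

section Probability

variable {b R : ℕ}

/-- **Weighted injections** (the one inequality of every Peierls argument): if `Φ` is injective on
a set `E` of finite configurations and divides the Boltzmann weight by at least `c⁻¹` there, then the
total weight of `E` is at most `c Z`. [cite: FriedliVelenik2017, Lemma 3.36 (proof)] -/
theorem sum_isingWeight_le_of_injOn {W : Type*} [DecidableEq W] (G' : SimpleGraph W) [G'.LocallyFinite]
    {Λ : Finset W} (β h : ℝ) (bc : BoundaryCondition W) (E : Finset (Λ → ℤˣ)) (Φ : (Λ → ℤˣ) → (Λ → ℤˣ))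
    (hinj : Set.InjOn Φ ↑E) {c : ℝ} (hc : 0 ≤ c) (hw : ∀ τ ∈ E, isingWeight G' Λ β h bc τ ≤ c * isingWeight G' Λ β h bc (Φ τ)) :
    ∑ τ ∈ E, isingWeight G' Λ β h bc τ ≤ c * isingPartitionFunction G' Λ β h bc := by
  classical
  calc ∑ τ ∈ E, isingWeight G' Λ β h bc τ ≤ ∑ τ ∈ E, c * isingWeight G' Λ β h bc (Φ τ) := sum_le_sum hw
    _ = c * ∑ τ' ∈ E.image Φ, isingWeight G' Λ β h bc τ' := by rw [mul_sum, sum_image hinj]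
    _ ≤ c * isingPartitionFunction G' Λ β h bc := by
        refine mul_le_mul_of_nonneg_left ?_ hc
        exact sum_le_sum_of_subset_of_nonneg (subset_univ _) fun τ _ _ => (isingWeight_pos G' Λ β h bc τ).le

variable (b R)

/-- The finite configurations of `Λ^int_{R'}` (alternating image spins of parity `p`, `+` elsewhere)
of which `γ` is a contour. [cite: FriedliVelenik2017, §3.7.2 (the event γ ⊆ Γ(ω))] -/
def contourEvent (p : ℤˣ) (R' : ℕ) (γ : Finset (Site d)) : Finset (spacingIntVolume d b R' → ℤˣ) :=
  open Classical in
  univ.filter fun τ => IsContourOf b R (glue (spacingIntVolume d b R') τ (.fixed (signedCoreAnnulusBC d b p R' R' 1 1))) γ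

variable {b R}

/-- Membership in `contourEvent`. [folklore] -/
theorem mem_contourEvent {p : ℤˣ} {R' : ℕ} {γ : Finset (Site d)} {τ : spacingIntVolume d b R' → ℤˣ} :
    τ ∈ contourEvent b R p R' γ ↔
      IsContourOf b R (glue (spacingIntVolume d b R') τ (.fixed (signedCoreAnnulusBC d b p R' R' 1 1))) γ := by
  classical
  rw [contourEvent, mem_filter]
  exact ⟨fun h => h.2, fun h => ⟨mem_univ _, h⟩⟩

/-- Glued configurations are the boundary condition off the volume. [folklore] -/
theorem glue_apply_of_notMem' {Λ : Finset (Site d)} (τ : Λ → ℤˣ) (ζ : SpinConfig (Site d)) :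
    ∀ x, x ∉ Λ → glue Λ τ (.fixed ζ) x = ζ x := fun x hx => by
  rw [glue_apply_of_notMem Λ τ _ hx]; rfl

/-- **The Peierls bound for one contour**: the total weight of the configurations of which `γ` is a
contour is at most `2^{#K} e^{-β #γ/(2R+1)^d} Z`, `K` the `(R+1)`-neighbourhood of `γ` (sum over
the configuration on `K`; on each class the erasure is injective and gains `e^{-β #γ/(2R+1)^d}`).
[cite: FriedliVelenik2017, §3.7.2 Lemma 3.36 and eq. (3.38); VanenterFernandezSokal1993, App. B.5.3] -/
theorem sum_contourEvent_le (hd : 2 ≤ d) (hb : 2 ≤ b) (hRb : b + 1 ≤ R) {β : ℝ} (hβ : 0 ≤ β) (p : ℤˣ) (R' : ℕ)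
    (γ : Finset (Site d)) :
    ∑ τ ∈ contourEvent b R p R' γ, isingWeight (zdGraph d) (spacingIntVolume d b R') β 0
        (.fixed (signedCoreAnnulusBC d b p R' R' 1 1)) τ ≤
      (2 : ℝ) ^ #(γ.biUnion (ball (R + 1))) * Real.exp (-(β * (#γ / (2 * R + 1) ^ d))) *
        isingPartitionFunction (zdGraph d) (spacingIntVolume d b R') β 0 (.fixed (signedCoreAnnulusBC d b p R' R' 1 1)) := by
  classical
  have hd1 : 1 ≤ d := by omega
  set i₀ : Fin d := ⟨0, hd1⟩
  set Λ := spacingIntVolume d b R' with hΛ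
  set ζ := signedCoreAnnulusBC d b p R' R' 1 1 with hζ
  set K := γ.biUnion (ball (R + 1)) with hK
  set c := Real.exp (-(β * (#γ / (2 * R + 1) ^ d))) with hc
  set E := contourEvent b R p R' γ with hE
  -- restriction to `K` and the fibres
  set res : (Λ → ℤˣ) → (K → ℤˣ) := fun τ k => glue Λ τ (.fixed ζ) k with hres
  rw [← sum_fiberwise E res]
  -- each fibre: injective erasure
  have hfib : ∀ π : K → ℤˣ, ∑ τ ∈ E.filter (fun τ => res τ = π), isingWeight (zdGraph d) Λ β 0 (.fixed ζ) τ ≤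
      c * isingPartitionFunction (zdGraph d) Λ β 0 (.fixed ζ) := by
    intro π
    set Φ : (Λ → ℤˣ) → (Λ → ℤˣ) := fun τ x => eraseContour b R i₀ (glue Λ τ (.fixed ζ)) γ x with hΦ
    have hglueΦ : ∀ τ ∈ E, glue Λ (Φ τ) (.fixed ζ) = eraseContour b R i₀ (glue Λ τ (.fixed ζ)) γ := by
      intro τ hτ
      funext x
      by_cases hx : x ∈ Λ
      · rw [glue_apply_of_mem _ _ _ hx]
      · rw [glue_apply_of_notMem' _ _ x hx,
          eraseContour_apply_of_notMem_volume hd hb (by omega) (by omega) (glue_apply_of_notMem' τ ζ)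
            (mem_contourEvent.1 hτ) i₀ hx]
    refine sum_isingWeight_le_of_injOn (zdGraph d) β 0 (.fixed ζ) _ Φ ?_ (Real.exp_nonneg _) ?_
    · intro τ₁ hτ₁ τ₂ hτ₂ hΦeq
      obtain ⟨hτ₁E, hτ₁π⟩ := mem_filter.1 (mem_coe.1 hτ₁)
      obtain ⟨hτ₂E, hτ₂π⟩ := mem_filter.1 (mem_coe.1 hτ₂)
      have hE12 : eraseContour b R i₀ (glue Λ τ₁ (.fixed ζ)) γ = eraseContour b R i₀ (glue Λ τ₂ (.fixed ζ)) γ := by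
        rw [← hglueΦ τ₁ hτ₁E, ← hglueΦ τ₂ hτ₂E, hΦeq]
      have hK12 : ∀ v ∈ K, glue Λ τ₁ (.fixed ζ) v = glue Λ τ₂ (.fixed ζ) v := fun v hv => by
        have := congrFun (hτ₁π.trans hτ₂π.symm) ⟨v, hv⟩
        exact this
      have := eq_of_eraseContour_eq hd hb hRb (mem_contourEvent.1 hτ₁E) (mem_contourEvent.1 hτ₂E) i₀ hK12 hE12
      exact glue_injective Λ (.fixed ζ) this
    · intro τ hτ
      obtain ⟨hτE, -⟩ := mem_filter.1 hτ
      have hgap := card_div_le_isingHamiltonian_sub_eraseContour hd hb hRb (glue_apply_of_notMem' τ ζ)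
        (mem_contourEvent.1 hτE) i₀
      rw [isingWeight, isingWeight, hglueΦ τ hτE, hc, ← Real.exp_add]
      exact Real.exp_le_exp.2 (by nlinarith)
  calc ∑ π : K → ℤˣ, ∑ τ ∈ E.filter (fun τ => res τ = π), isingWeight (zdGraph d) Λ β 0 (.fixed ζ) τ
      ≤ ∑ π : K → ℤˣ, c * isingPartitionFunction (zdGraph d) Λ β 0 (.fixed ζ) := sum_le_sum fun π _ => hfib π
    _ = (2 : ℝ) ^ #K * c * isingPartitionFunction (zdGraph d) Λ β 0 (.fixed ζ) := by
        rw [sum_const, card_univ, Fintype.card_fun, Fintype.card_units_int, Fintype.card_coe, nsmul_eq_mul]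
        push_cast
        ring

/-- The `(R+1)`-neighbourhood of `γ` has at most `(2R+3)^d #γ` points. [folklore] -/
theorem card_biUnion_ball_le (γ : Finset (Site d)) : #(γ.biUnion (ball (R + 1))) ≤ (2 * R + 3) ^ d * #γ := by
  classical
  calc #(γ.biUnion (ball (R + 1))) ≤ ∑ g ∈ γ, #(ball (R + 1) g) := card_biUnion_le
    _ = ∑ g ∈ γ, (2 * R + 3) ^ d := sum_congr rfl fun g _ => by rw [card_ball]; ring_nf
    _ = (2 * R + 3) ^ d * #γ := by rw [sum_const, smul_eq_mul, mul_comm]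

variable (R) in
/-- **The contours that can enclose `u`**: non-empty `★`-connected subsets of `box d (N + R)` whose
hull contains `u`. [cite: FriedliVelenik2017, §3.7.2 (contours surrounding the origin)] -/
def enclosingContours (N : ℕ) (u : Site d) : Finset (Finset (Site d)) :=
  open Classical in
  (box d (N + R)).powerset.filter fun γ => γ.Nonempty ∧ StarConn (γ : Set (Site d)) ∧ u ∉ starExt γ

/-- Membership in `enclosingContours`. [folklore] -/
theorem mem_enclosingContours {N : ℕ} {u : Site d} {γ : Finset (Site d)} :
    γ ∈ enclosingContours R N u ↔ γ ⊆ box d (N + R) ∧ γ.Nonempty ∧ StarConn (γ : Set (Site d)) ∧ u ∉ starExt γ := by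
  classical
  rw [enclosingContours, mem_filter, mem_powerset]

/-- **Counting the contours that can enclose `u`**: those of size `n` lie in `ball (n-1) u` and are
`★`-lattice animals through one of its points: at most `(2n-1)^d (3^d)^{2(n-1)}` of them.
[cite: FriedliVelenik2017, §3.7.2 eq. (3.34) and Lemma 7.30] -/
theorem card_enclosingContours_filter_le (hd : 2 ≤ d) {N : ℕ} (u : Site d) (n : ℕ) :
    #((enclosingContours R N u).filter fun γ => #γ = n) ≤ (2 * (n - 1) + 1) ^ d * (3 ^ d) ^ (2 * (n - 1)) := by
  classical
  set 𝒜 := (enclosingContours R N u).filter fun γ => #γ = n with h𝒜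
  have hsub : 𝒜 ⊆ (ball (n - 1) u).biUnion fun v => 𝒜.filter fun γ => v ∈ γ := by
    intro γ hγ
    obtain ⟨hγE, hγn⟩ := mem_filter.1 hγ
    obtain ⟨-, hne, hconn, hu⟩ := mem_enclosingContours.1 hγE
    obtain ⟨g, hg⟩ := hne
    have hgb : g ∈ ball (n - 1) u := by
      have := subset_ball_of_not_mem_starExt hd hconn hu hg
      rwa [hγn] at this
    exact mem_biUnion.2 ⟨g, hgb, mem_filter.2 ⟨hγ, hg⟩⟩
  calc #𝒜 ≤ #((ball (n - 1) u).biUnion fun v => 𝒜.filter fun γ => v ∈ γ) := card_le_card hsub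
    _ ≤ ∑ v ∈ ball (n - 1) u, #(𝒜.filter fun γ => v ∈ γ) := card_biUnion_le
    _ ≤ ∑ v ∈ ball (n - 1) u, (3 ^ d) ^ (2 * (n - 1)) := sum_le_sum fun v _ => by
        refine ContourSetup.card_filter_starConn_le v n _ fun A hA => ?_
        obtain ⟨hA, hvA⟩ := mem_filter.1 hA
        obtain ⟨hAE, hAn⟩ := mem_filter.1 hA
        exact ⟨hvA, hAn, (mem_enclosingContours.1 hAE).2.2.1⟩
    _ = (2 * (n - 1) + 1) ^ d * (3 ^ d) ^ (2 * (n - 1)) := by rw [sum_const, card_ball, smul_eq_mul]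

end Probability

/-! ### Summing over contours: the Peierls estimate for the internal spin at a site -/

section Total

variable {b R : ℕ}

/-- Subadditivity of non-negative sums over a union of finsets. [folklore] -/
theorem sum_biUnion_le_sum_of_nonneg {ι κ : Type*} [DecidableEq κ] (s : Finset ι) (t : ι → Finset κ) {f : κ → ℝ}
    (hf : ∀ x, 0 ≤ f x) : ∑ x ∈ s.biUnion t, f x ≤ ∑ i ∈ s, ∑ x ∈ t i, f x := by
  classical
  induction s using Finset.induction_on with
  | empty => simp
  | insert a s ha ih =>
    rw [Finset.biUnion_insert, Finset.sum_insert ha]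
    have h1 := Finset.sum_union_inter (s₁ := t a) (s₂ := s.biUnion t) (f := f)
    have h2 : 0 ≤ ∑ x ∈ t a ∩ s.biUnion t, f x := sum_nonneg fun x _ => hf x
    linarith

/-- **All configurations with a `-` internal spin at `u` have an enclosing contour**, so their total
weight is bounded by the sum of the one-contour bounds over the possible enclosing contours.
[cite: FriedliVelenik2017, §3.7.2 eqs. (3.36)–(3.39)] -/
theorem sum_isingWeight_neg_le (hd : 2 ≤ d) (hb : 2 ≤ b) (hRb : b + 1 ≤ R) {β : ℝ} (hβ : 0 ≤ β) (p : ℤˣ)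
    (R' : ℕ) {u : Site d} (hui : ¬ IsSpImageSite d b u) :
    ∑ τ ∈ univ.filter (fun τ : spacingIntVolume d b R' → ℤˣ =>
        glue (spacingIntVolume d b R') τ (.fixed (signedCoreAnnulusBC d b p R' R' 1 1)) u = -1),
      isingWeight (zdGraph d) (spacingIntVolume d b R') β 0 (.fixed (signedCoreAnnulusBC d b p R' R' 1 1)) τ ≤
      (∑ γ ∈ enclosingContours R (b * R') u,
          (2 : ℝ) ^ #(γ.biUnion (ball (R + 1))) * Real.exp (-(β * (#γ / (2 * R + 1) ^ d)))) *
        isingPartitionFunction (zdGraph d) (spacingIntVolume d b R') β 0 (.fixed (signedCoreAnnulusBC d b p R' R' 1 1)) := by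
  classical
  have hR : 2 ≤ R := by omega
  set Λ := spacingIntVolume d b R' with hΛ
  set ζ := signedCoreAnnulusBC d b p R' R' 1 1 with hζ
  set S := univ.filter (fun τ : Λ → ℤˣ => glue Λ τ (.fixed ζ) u = -1) with hS
  have hsub : S ⊆ (enclosingContours R (b * R') u).biUnion (contourEvent b R p R') := by
    intro τ hτ
    obtain ⟨-, hτu⟩ := mem_filter.1 hτ
    have hω : PlusOutside b (b * R') (glue Λ τ (.fixed ζ)) := plusOutside_of_eqOn (glue_apply_of_notMem' τ ζ)
    obtain ⟨γ, hγ, hγbox, huγ⟩ := exists_contour_enclosing hd hb hR hω hui hτu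
    exact mem_biUnion.2 ⟨γ, mem_enclosingContours.2 ⟨hγbox, hγ.nonempty, hγ.starConn, huγ⟩, mem_contourEvent.2 hγ⟩
  have hw0 : ∀ τ : Λ → ℤˣ, 0 ≤ isingWeight (zdGraph d) Λ β 0 (.fixed ζ) τ := fun τ => (isingWeight_pos _ _ _ _ _ τ).le
  calc ∑ τ ∈ S, isingWeight (zdGraph d) Λ β 0 (.fixed ζ) τ
      ≤ ∑ τ ∈ (enclosingContours R (b * R') u).biUnion (contourEvent b R p R'), isingWeight (zdGraph d) Λ β 0 (.fixed ζ) τ :=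
        sum_le_sum_of_subset_of_nonneg hsub fun τ _ _ => hw0 τ
    _ ≤ ∑ γ ∈ enclosingContours R (b * R') u, ∑ τ ∈ contourEvent b R p R' γ, isingWeight (zdGraph d) Λ β 0 (.fixed ζ) τ :=
        sum_biUnion_le_sum_of_nonneg _ _ hw0
    _ ≤ ∑ γ ∈ enclosingContours R (b * R') u,
          (2 : ℝ) ^ #(γ.biUnion (ball (R + 1))) * Real.exp (-(β * (#γ / (2 * R + 1) ^ d))) *
            isingPartitionFunction (zdGraph d) Λ β 0 (.fixed ζ) :=
        sum_le_sum fun γ _ => sum_contourEvent_le hd hb hRb hβ p R' γ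
    _ = _ := by rw [sum_mul]

/-- **The probability of a `-` internal spin is bounded by the contour sum**:
`⟨(1 - σ_u)/2⟩ ≤ ∑_{γ enclosing u} 2^{#K(γ)} e^{-β #γ/(2R+1)^d}` in the system
`⟨Λ^int_{R'}; p·ω'_alt; +⟩`, for every internal site `u`, both parities and all `R'`.
[cite: FriedliVelenik2017, §3.7.2 eq. (3.39)] -/
theorem isingExpect_neg_indicator_le_sum (hd : 2 ≤ d) (hb : 2 ≤ b) (hRb : b + 1 ≤ R) {β : ℝ} (hβ : 0 ≤ β) (p : ℤˣ)
    (R' : ℕ) {u : Site d} (hui : ¬ IsSpImageSite d b u) :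
    isingExpect (zdGraph d) (spacingIntVolume d b R') β 0 (.fixed (signedCoreAnnulusBC d b p R' R' 1 1))
        (fun σ => (1 - spinAt u σ) / 2) ≤
      ∑ γ ∈ enclosingContours R (b * R') u,
        (2 : ℝ) ^ #(γ.biUnion (ball (R + 1))) * Real.exp (-(β * (#γ / (2 * R + 1) ^ d))) := by
  classical
  set Λ := spacingIntVolume d b R' with hΛ
  set ζ := signedCoreAnnulusBC d b p R' R' 1 1 with hζ
  have hfm : Measurable fun σ : SpinConfig (Site d) => (1 - spinAt u σ) / 2 :=
    (measurable_const.sub (measurable_spinAt u)).div_const 2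
  rw [isingExpect_eq_sum_div (zdGraph d) Λ 0 (.fixed ζ) β hfm, div_le_iff₀ (isingPartitionFunction_pos _ _ _ _ _)]
  have hind : ∀ τ : Λ → ℤˣ, isingWeight (zdGraph d) Λ β 0 (.fixed ζ) τ * ((1 - spinAt u (glue Λ τ (.fixed ζ))) / 2) =
      if glue Λ τ (.fixed ζ) u = -1 then isingWeight (zdGraph d) Λ β 0 (.fixed ζ) τ else 0 := by
    intro τ
    rcases Int.units_eq_one_or (glue Λ τ (.fixed ζ) u) with h | h
    · rw [if_neg (by rw [h]; decide)]; simp [spinAt, h]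
    · rw [if_pos h]; simp [spinAt, h]
  rw [sum_congr rfl fun τ _ => hind τ, ← sum_filter]
  exact sum_isingWeight_neg_le hd hb hRb hβ p R' hui

/-- A finite sum of the geometric terms `Q r^{n-1}` over sizes `n ≥ 1` is at most `Q / (1 - r)`.
[folklore] -/
theorem sum_mul_pow_pred_le {T : Finset ℕ} (hT : ∀ n ∈ T, 1 ≤ n) {Q r : ℝ} (hQ : 0 ≤ Q) (hr0 : 0 ≤ r) (hr1 : r < 1) :
    ∑ n ∈ T, Q * r ^ (n - 1) ≤ Q / (1 - r) := by
  classical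
  have hinj : Set.InjOn (fun n => n - 1) ↑T := by
    intro a ha c hc h
    have := hT a (mem_coe.1 ha); have := hT c (mem_coe.1 hc)
    simp only at h; omega
  have h1 : ∑ n ∈ T, Q * r ^ (n - 1) = ∑ m ∈ T.image (fun n => n - 1), Q * r ^ m := by
    rw [sum_image hinj]
  rw [h1]
  have hs : Summable (fun m : ℕ => Q * r ^ m) := (summable_geometric_of_lt_one hr0 hr1).mul_left Q
  calc ∑ m ∈ T.image (fun n => n - 1), Q * r ^ m ≤ ∑' m, Q * r ^ m := hs.sum_le_tsum _ (fun m _ => by positivity)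
    _ = Q / (1 - r) := by rw [tsum_mul_left, tsum_geometric_of_lt_one hr0 hr1, div_eq_mul_inv]

/-- **The Peierls estimate for the internal-spin system with fully alternating image spins**
(both parities, every volume `Λ^int_{R'}`, every internal site `u`; goodness radius `R = b + 1`):
with `Q = 2^{(2R+3)^d} e^{-β/(2R+1)^d}`, if `27^d Q ≤ 1/2` then `⟨(1 - σ_u)/2⟩ ≤ 2Q` — the
low-temperature order that van Enter–Fernández–Sokal obtain from Pirogov–Sinai theory, here from the
contour-erasing Peierls argument (sum over sizes `n` of: number of enclosing `★`-animals
`≤ (2n-1)^d 9^{d(n-1)} ≤ 27^{d(n-1)}`, patterns `2^{#K} ≤ 2^{(2R+3)^d n}`, energy `e^{-β n/(2R+1)^d}`).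
[cite: VanenterFernandezSokal1993, §4.3.2 and App. B.5.3 (B.79); FriedliVelenik2017, §3.7.2 eqs. (3.39)–(3.40)] -/
theorem isingExpect_neg_indicator_le (hd : 2 ≤ d) (hb : 2 ≤ b) {β : ℝ} (hβ : 0 ≤ β)
    (hsmall : (27 : ℝ) ^ d * ((2 : ℝ) ^ (2 * (b + 1) + 3) ^ d * Real.exp (-(β / (2 * ((b : ℝ) + 1) + 1) ^ d))) ≤ 1 / 2)
    (p : ℤˣ) (R' : ℕ) {u : Site d} (hui : ¬ IsSpImageSite d b u) :
    isingExpect (zdGraph d) (spacingIntVolume d b R') β 0 (.fixed (signedCoreAnnulusBC d b p R' R' 1 1))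
        (fun σ => (1 - spinAt u σ) / 2) ≤
      2 * ((2 : ℝ) ^ (2 * (b + 1) + 3) ^ d * Real.exp (-(β / (2 * ((b : ℝ) + 1) + 1) ^ d))) := by
  classical
  set Q : ℝ := (2 : ℝ) ^ (2 * (b + 1) + 3) ^ d * Real.exp (-(β / (2 * ((b : ℝ) + 1) + 1) ^ d)) with hQ
  set r : ℝ := (27 : ℝ) ^ d * Q with hr
  have hQ0 : 0 ≤ Q := by positivity
  have hr0 : 0 ≤ r := by positivity
  have hrhalf : r ≤ 1 / 2 := hsmall
  have hr1 : r < 1 := by linarith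
  have h1 := isingExpect_neg_indicator_le_sum hd hb (le_refl (b + 1)) hβ p R' hui (R := b + 1)
  push_cast at h1
  refine h1.trans ?_
  set 𝒢 := enclosingContours (b + 1) (b * R') u with h𝒢
  -- each term is at most `Q^{#γ}`
  have hterm : ∀ γ ∈ 𝒢, (2 : ℝ) ^ #(γ.biUnion (ball (b + 1 + 1))) *
      Real.exp (-(β * (#γ / (2 * ((b : ℝ) + 1) + 1) ^ d))) ≤ Q ^ #γ := by
    intro γ _
    rw [hQ, mul_pow, ← Real.exp_nat_mul, ← pow_mul]
    refine mul_le_mul ?_ (le_of_eq ?_) (Real.exp_nonneg _) (by positivity)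
    · exact pow_le_pow_right₀ (by norm_num) (card_biUnion_ball_le γ)
    · congr 1; ring
  refine (sum_le_sum hterm).trans ?_
  -- group by size
  rw [sum_comp (fun n : ℕ => Q ^ n) (fun γ : Finset (Site d) => #γ)]
  have hsizes : ∀ n ∈ 𝒢.image (fun γ : Finset (Site d) => #γ), 1 ≤ n := by
    intro n hn
    obtain ⟨γ, hγ, rfl⟩ := mem_image.1 hn
    exact card_pos.2 (mem_enclosingContours.1 hγ).2.1
  have hcount : ∀ n ∈ 𝒢.image (fun γ : Finset (Site d) => #γ),
      (#(𝒢.filter fun γ => #γ = n) : ℕ) • Q ^ n ≤ Q * r ^ (n - 1) := by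
    intro n hn
    have hn1 := hsizes n hn
    have hc := card_enclosingContours_filter_le hd u n (R := b + 1) (N := b * R')
    have h3 : 2 * (n - 1) + 1 ≤ 3 ^ (n - 1) := two_mul_add_one_le_three_pow (n - 1)
    have hc' : (#(𝒢.filter fun γ => #γ = n) : ℝ) ≤ (27 : ℝ) ^ (d * (n - 1)) := by
      have h4 : (2 * (n - 1) + 1) ^ d * (3 ^ d) ^ (2 * (n - 1)) ≤ (3 ^ (n - 1)) ^ d * (3 ^ d) ^ (2 * (n - 1)) :=
        Nat.mul_le_mul_right _ (Nat.pow_le_pow_left h3 d)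
      have h5 : (3 ^ (n - 1)) ^ d * (3 ^ d) ^ (2 * (n - 1)) = 27 ^ (d * (n - 1)) := by
        rw [← pow_mul, ← pow_mul, ← pow_add, show (27 : ℕ) = 3 ^ 3 by norm_num, ← pow_mul]
        congr 1; ring
      have := hc.trans h4
      rw [h5] at this
      exact_mod_cast this
    rw [nsmul_eq_mul]
    have hQn : Q ^ n = Q * Q ^ (n - 1) := by
      conv_lhs => rw [show n = (n - 1) + 1 by omega, pow_succ]
      ring
    have hrpow : r ^ (n - 1) = (27 : ℝ) ^ (d * (n - 1)) * Q ^ (n - 1) := by rw [hr, mul_pow, ← pow_mul]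
    rw [hQn, hrpow]
    have hnn : (0 : ℝ) ≤ Q * Q ^ (n - 1) := by positivity
    calc (#(𝒢.filter fun γ => #γ = n) : ℝ) * (Q * Q ^ (n - 1))
        ≤ (27 : ℝ) ^ (d * (n - 1)) * (Q * Q ^ (n - 1)) := mul_le_mul_of_nonneg_right hc' hnn
      _ = Q * ((27 : ℝ) ^ (d * (n - 1)) * Q ^ (n - 1)) := by ring
  calc ∑ n ∈ 𝒢.image (fun γ : Finset (Site d) => #γ), (#(𝒢.filter fun γ => #γ = n) : ℕ) • Q ^ n
      ≤ ∑ n ∈ 𝒢.image (fun γ : Finset (Site d) => #γ), Q * r ^ (n - 1) := sum_le_sum hcount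
    _ ≤ Q / (1 - r) := sum_mul_pow_pred_le hsizes hQ0 hr0 hr1
    _ ≤ 2 * Q := by
        rw [div_le_iff₀ (by linarith)]
        nlinarith

end Total

end Literature.Barriers.CriticalPhenomena.NonGibbs

end
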